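import Mathlib
import Literature.Analysis.FunctionSpaces.PlancherelL1L2
import Summits.NavierStokesRegularity.NavierStokesRegularity.Theorems.FilamentSkeletonRssClause13SmoothingKernelPlancherel
import Summits.NavierStokesRegularity.NavierStokesRegularity.Theorems.FilamentSkeletonRssClause13SmoothingKernelMoment
import Summits.NavierStokesRegularity.NavierStokesRegularity.Theorems.FilamentSkeletonRssClause13LowSliceForm
import Summits.NavierStokesRegularity.NavierStokesRegularity.Theorems.FilamentSkeletonRssClause13BallPoincareComplex

/-!
# Clause 13-J/13-R, brick B5 (band virial) — TOOLS: `|𝔖′| ≤ π`, the POLARISED Plancherel form of `K_q`,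
# and the derivative of the un-normalised transform `F′ = i·(transform of x·f)`

Route `FilamentSkeletonRss`, ∃-side clause 13 (`Clause13RNearStraightL` stmt-NavierStokesRegularity-23612 = A1R twin of
`Clause13NearStraightL` 23321; typing-agnostic); design of record `filament-plan/DESIGN-NOTE-28296-tenure-g22.md` §4
("the Mourre estimate is a 3-line virial identity in L², conjugate operator A = τ − c … [τ, m(D)] = −i m′(D)").  The band
virial's symbol side (next file, `…Clause13BandVirial`) integrates by parts against the multiplier `m_q(z) = (2/q)(1 − 𝔖(z√q))`
of `K_q` (p664709/p665209) after polarising the Plancherel form; this file supplies the three analytic inputs: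

* §1 `abs_deriv_liaSym_le` — the symbol's derivative is BOUNDED, `|𝔖′| ≤ π` (from `𝔖 = 1 − ½Re 𝓕K₁(·/2π)`, p671805, and
  `‖𝓕((−2πi x)·K₁)‖_∞ ≤ 2π‖x·K₁‖₁ ≤ 4π²`), with the explicit `hasDerivAt_liaSym`;
* §2 `integral_prod_smoothingKernel_sub_polar` — `∫∫K_q(t−u)f(u)conj g(t) = (1/2π)∫ m_q(z)F(z)conj G(z)dz` for `f, g ∈ L¹`
  (`F(z) = ∫f(x)e^{izx}dx`; the `f = g` case is p665209's `integral_prod_smoothingKernel_sub`, same Fubini proof);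
* §3 `hasDerivAt_unnormalisedTransform` — `F′(z) = i·∫x f(x)e^{izx}dx` for `f, x·f ∈ L¹` (Mathlib `Real.hasDerivAt_fourier` through
  the dictionary `F(z) = 𝓕f(−z/2π)`, p669628), plus `continuous_unnormalisedTransform`, `norm_unnormalisedTransform_le`.

Lane ns-filament-19175-p1 g15; `--supports stmt-NavierStokesRegularity-23612 --as helper`.
HONEST FRAMING: harmonic analysis of an explicit model kernel attached to a HYPOTHETICAL filament skeleton on the NEGATIVE side of a
MODEL route; nothing here bears on Navier–Stokes regularity or blow-up; 23610/23611/23612/23320 stay OPEN.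
-/

noncomputable section

open MeasureTheory Real Complex Filter Set
open scoped FourierTransform ComplexConjugate Topology
open Summit.NavierStokesRegularity.NavierStokesRegularity.Theorems.AnalyticStripLiaSymbol (liaSym liaSym_neg liaSym_zero
  one_sub_liaSym_nonneg one_sub_liaSym_le_exp)

namespace Summit.NavierStokesRegularity.NavierStokesRegularity.Theorems.MatchedKernel
set_option linter.dupNamespace false

/-! ## §1 The derivative of the symbol is bounded: `|𝔖′| ≤ π` -/

/-- `‖x·K₁‖₁ ≤ 2π`: `∫‖(−2πi s)•K₁(s)‖ds ≤ 4π²`. [folklore] -/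
theorem integral_norm_smul_smoothingKernel_one_le :
    ∫ s : ℝ, ‖(-2 * π * I * s) • ((((2 * 1 - s ^ 2) * ((s ^ 2 + 1) ^ (5 / 2 : ℝ))⁻¹ : ℝ)) : ℂ)‖ ≤ 4 * π ^ 2 := by
  have hpt : ∀ s : ℝ, ‖(-2 * π * I * s) • ((((2 * 1 - s ^ 2) * ((s ^ 2 + 1) ^ (5 / 2 : ℝ))⁻¹ : ℝ)) : ℂ)‖
      = 2 * π * |s * ((2 * 1 - s ^ 2) * ((s ^ 2 + 1) ^ (5 / 2 : ℝ))⁻¹)| := by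
    intro s
    rw [norm_smul, Complex.norm_real, Real.norm_eq_abs, abs_mul s]
    have h2 : ‖(-2 * π * I * s : ℂ)‖ = 2 * π * |s| := by
      rw [show (-2 * π * I * s : ℂ) = (((-(2 * π * s)) : ℝ) : ℂ) * I by push_cast; ring, norm_mul, Complex.norm_I,
        mul_one, Complex.norm_real, Real.norm_eq_abs, abs_neg, abs_mul, abs_of_pos Real.two_pi_pos]
    rw [h2]; ring
  simp_rw [hpt]
  have hle : ∀ s : ℝ, 2 * π * |s * ((2 * 1 - s ^ 2) * ((s ^ 2 + 1) ^ (5 / 2 : ℝ))⁻¹)|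
      ≤ 2 * π * (2 * max 1 (1:ℝ)⁻¹ * (1 + s ^ 2)⁻¹) := fun s =>
    mul_le_mul_of_nonneg_left (abs_mul_smoothingKernel_le one_pos s) (by positivity)
  have hint : Integrable (fun s : ℝ => 2 * π * (2 * max 1 (1:ℝ)⁻¹ * (1 + s ^ 2)⁻¹)) :=
    (integrable_inv_one_add_sq.const_mul (2 * max 1 (1:ℝ)⁻¹)).const_mul (2 * π)
  have hint0 : Integrable (fun s : ℝ => 2 * π * |s * ((2 * 1 - s ^ 2) * ((s ^ 2 + 1) ^ (5 / 2 : ℝ))⁻¹)|) :=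
    ((integrable_mul_smoothingKernel one_pos).abs).const_mul (2 * π)
  calc ∫ s : ℝ, 2 * π * |s * ((2 * 1 - s ^ 2) * ((s ^ 2 + 1) ^ (5 / 2 : ℝ))⁻¹)|
      ≤ ∫ s : ℝ, 2 * π * (2 * max 1 (1:ℝ)⁻¹ * (1 + s ^ 2)⁻¹) := integral_mono hint0 hint hle
    _ = 2 * π * (2 * max 1 (1:ℝ)⁻¹ * π) := by
        rw [integral_const_mul, integral_const_mul, integral_univ_inv_one_add_sq]
    _ = 4 * π ^ 2 := by rw [inv_one, max_self]; ring

/-- The derivative of `𝔖`, explicitly: `𝔖′(x) = −Re[(1/2π)•𝓕((−2πi s)•K₁)(x/2π)]/2`. [folklore] -/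
theorem hasDerivAt_liaSym (x : ℝ) :
    HasDerivAt liaSym
      (-((((1 / (2 * π) : ℝ) : ℂ) * 𝓕 (fun s : ℝ => (-2 * π * I * s) •
        ((((2 * 1 - s ^ 2) * ((s ^ 2 + 1) ^ (5 / 2 : ℝ))⁻¹ : ℝ)) : ℂ)) (x / (2 * π))).re / 2)) x := by
  have hfun : liaSym = fun x => 1 - (𝓕 (fun s : ℝ => (((2 * 1 - s ^ 2) * ((s ^ 2 + 1) ^ (5 / 2 : ℝ))⁻¹ : ℝ) : ℂ))
      (x / (2 * π))).re / 2 := by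
    funext x
    rw [fourier_smoothingKernel one_pos, Complex.ofReal_re, Real.sqrt_one, mul_one,
      show 2 * π * (x / (2 * π)) = x by field_simp]
    ring
  rw [hfun]
  have h1 := hasDerivAt_fourier_smoothingKernel one_pos (x / (2 * π))
  have h2 : HasDerivAt (fun x : ℝ => x / (2 * π)) (1 / (2 * π)) x := by
    have h := (hasDerivAt_id x).div_const (2 * π)
    simpa [one_div] using h
  have h3 := h1.scomp x h2
  rw [Complex.real_smul] at h3
  have h4 := hasDerivAt_re_comp h3
  exact (h4.div_const 2).const_sub 1

/-- **`|𝔖′| ≤ π`** (crude but uniform: `|𝔖′(x)| ≤ ‖x·K₁‖₁/2 ≤ π`). [folklore] -/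
theorem abs_deriv_liaSym_le (x : ℝ) : |deriv liaSym x| ≤ π := by
  rw [(hasDerivAt_liaSym x).deriv]
  set w : ℂ := 𝓕 (fun s : ℝ => (-2 * π * I * s) •
        ((((2 * 1 - s ^ 2) * ((s ^ 2 + 1) ^ (5 / 2 : ℝ))⁻¹ : ℝ)) : ℂ)) (x / (2 * π)) with hw
  -- `‖𝓕 g ξ‖ ≤ ‖g‖₁` (as in the tree's `ConvolutionFormBound`), then §1's `L¹` bound
  have hwn : ‖w‖ ≤ 4 * π ^ 2 := by
    refine le_trans ?_ integral_norm_smul_smoothingKernel_one_le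
    rw [hw, Real.fourier_eq]
    refine (norm_integral_le_integral_norm _).trans (le_of_eq ?_)
    congr 1 with s
    rw [Circle.norm_smul]
  have hre : abs ((((1 / (2 * π) : ℝ) : ℂ) * w).re) ≤ 1 / (2 * π) * (4 * π ^ 2) := by
    rw [Complex.re_ofReal_mul, _root_.abs_mul, _root_.abs_of_pos (by positivity : (0:ℝ) < 1 / (2 * π))]
    exact mul_le_mul_of_nonneg_left ((Complex.abs_re_le_norm w).trans hwn) (by positivity)
  rw [_root_.abs_neg, _root_.abs_div, _root_.abs_two]
  calc abs ((((1 / (2 * π) : ℝ) : ℂ) * w).re) / 2 ≤ (1 / (2 * π) * (4 * π ^ 2)) / 2 := by gcongr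
    _ = π := by field_simp; ring

/-! ## §2 The polarised Plancherel form of `K_q` -/

/-- `conj ∘ g` is integrable when `g` is. [folklore] -/
theorem integrable_conj_comp {g : ℝ → ℂ} (hg : Integrable g) : Integrable fun x : ℝ => conj (g x) :=
  hg.mono (Complex.continuous_conj.comp_aestronglyMeasurable hg.aestronglyMeasurable)
    (Eventually.of_forall fun x => by simp)

/-- `(t, u) ↦ f(u) conj g(t)` is integrable on `ℝ × ℝ`. [folklore] -/
theorem integrable_prod_mul_conj {f g : ℝ → ℂ} (hf : Integrable f) (hg : Integrable g) :
    Integrable (fun p : ℝ × ℝ => f p.2 * conj (g p.1)) (volume.prod volume) := by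
  simpa [mul_comm] using (integrable_conj_comp hg).mul_prod hf

/-- `conj (e^{izt}) = e^{-izt}`. [folklore] -/
theorem conj_cexp_I_mul_mul (z t : ℝ) : conj (cexp (I * z * t)) = cexp (-(I * z * t)) := by
  rw [← Complex.exp_conj, map_mul, map_mul, Complex.conj_I, Complex.conj_ofReal, Complex.conj_ofReal]
  ring_nf

/-- `∫ conj g(t) e^{-izt} dt = conj (∫ g(t) e^{izt} dt)`. [folklore] -/
theorem integral_conj_mul_cexp_neg (g : ℝ → ℂ) (z : ℝ) :
    ∫ t : ℝ, conj (g t) * cexp (-(I * z * t)) = conj (∫ t : ℝ, g t * cexp (I * z * t)) := by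
  rw [← integral_conj]
  refine integral_congr_ae (Eventually.of_forall fun t => ?_)
  simp only [map_mul, conj_cexp_I_mul_mul]

/-- `∫_{ℝ×ℝ} e^{iz(u-t)} f(u) conj g(t) = F(z)·conj G(z)`. [folklore] -/
theorem integral_prod_cexp_mul_mul_conj (f g : ℝ → ℂ) (z : ℝ) :
    ∫ p : ℝ × ℝ, cexp (I * z * ((p.2 - p.1 : ℝ) : ℂ)) * (f p.2 * conj (g p.1)) ∂(volume.prod volume)
      = (∫ x : ℝ, f x * cexp (I * z * x)) * conj (∫ x : ℝ, g x * cexp (I * z * x)) := by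
  have h : ∀ p : ℝ × ℝ, cexp (I * z * ((p.2 - p.1 : ℝ) : ℂ)) * (f p.2 * conj (g p.1)) =
      (conj (g p.1) * cexp (-(I * z * p.1))) * (f p.2 * cexp (I * z * p.2)) := by
    intro p
    rw [show cexp (I * z * ((p.2 - p.1 : ℝ) : ℂ)) = cexp (-(I * z * p.1)) * cexp (I * z * p.2) by
      rw [← Complex.exp_add]; congr 1; push_cast; ring]
    ring
  simp_rw [h]
  rw [integral_prod_mul (fun t : ℝ => conj (g t) * cexp (-(I * z * t)))
    (fun u : ℝ => f u * cexp (I * z * u)), integral_conj_mul_cexp_neg, mul_comm]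

/-- Integrability of the triple integrand behind the Fubini step (polarised). [folklore] -/
theorem integrable_multiplier_mul_cexp_mul_polar {q : ℝ} (hq : 0 < q) {f g : ℝ → ℂ} (hf : Integrable f)
    (hg : Integrable g) :
    Integrable (fun r : (ℝ × ℝ) × ℝ =>
      (((2 / q * (1 - liaSym (r.2 * √q))) : ℝ) : ℂ) * cexp (I * r.2 * ((r.1.2 - r.1.1 : ℝ) : ℂ)) *
        (f r.1.2 * conj (g r.1.1))) ((volume.prod volume).prod volume) := by
  have hm := integrable_multiplier hq
  have hprod := (integrable_prod_mul_conj hf hg).mul_prod hm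
  have hphase : AEStronglyMeasurable
      (fun r : (ℝ × ℝ) × ℝ => cexp (I * r.2 * ((r.1.2 - r.1.1 : ℝ) : ℂ)))
      ((volume.prod volume).prod volume) := by
    refine (Continuous.aestronglyMeasurable ?_)
    fun_prop
  refine (hprod.bdd_mul hphase (c := 1) (Eventually.of_forall fun r => ?_)).congr
    (Eventually.of_forall fun r => ?_)
  · rw [Complex.norm_exp]
    simp only [Complex.mul_re, Complex.I_re, Complex.ofReal_re, zero_mul, Complex.I_im,
      Complex.ofReal_im, mul_zero, sub_zero, Complex.mul_im, one_mul, Real.exp_le_one_iff]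
    nlinarith [mul_self_nonneg (r.2 * (r.1.2 - r.1.1))]
  · simp only
    ring

/-- **Polarised Plancherel form of the smoothing kernel.**  For integrable `f, g : ℝ → ℂ` and `q > 0`,
`∫_{ℝ×ℝ} K_q(t−u) f(u) conj g(t) d(t,u) = (1/2π) ∫ (2/q)(1 − 𝔖(z√q))·F(z)·conj G(z) dz`,
`F(z) = ∫f(x)e^{izx}dx`, `G(z) = ∫g(x)e^{izx}dx`. [folklore] -/
theorem integral_prod_smoothingKernel_sub_polar {q : ℝ} (hq : 0 < q) {f g : ℝ → ℂ} (hf : Integrable f)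
    (hg : Integrable g) :
    ∫ p : ℝ × ℝ, ((((2 * q - (p.1 - p.2) ^ 2) * (((p.1 - p.2) ^ 2 + q) ^ (5 / 2 : ℝ))⁻¹ : ℝ)) : ℂ) * f p.2 * conj (g p.1)
        ∂(volume.prod volume) =
      (1 / (2 * π) : ℝ) * ∫ z : ℝ, (((2 / q * (1 - liaSym (z * √q))) : ℝ) : ℂ) *
        ((∫ x : ℝ, f x * cexp (I * z * x)) * conj (∫ x : ℝ, g x * cexp (I * z * x))) := by
  have hker : ∀ p : ℝ × ℝ, ((((2 * q - (p.1 - p.2) ^ 2) * (((p.1 - p.2) ^ 2 + q) ^ (5 / 2 : ℝ))⁻¹ : ℝ)) : ℂ)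
      * f p.2 * conj (g p.1) =
      ∫ z : ℝ, ((1 / (2 * π) : ℝ) : ℂ) * ((((2 / q * (1 - liaSym (z * √q))) : ℝ) : ℂ) *
        cexp (I * z * ((p.2 - p.1 : ℝ) : ℂ)) * (f p.2 * conj (g p.1))) := by
    intro p
    have hassoc : ∀ A B C D : ℂ, A * B * C * D = A * (B * (C * D)) := fun _ _ _ _ => by ring
    have hev : ((((2 * q - (p.1 - p.2) ^ 2) * (((p.1 - p.2) ^ 2 + q) ^ (5 / 2 : ℝ))⁻¹ : ℝ)) : ℂ)
        = ((((2 * q - (p.2 - p.1) ^ 2) * (((p.2 - p.1) ^ 2 + q) ^ (5 / 2 : ℝ))⁻¹ : ℝ)) : ℂ) := by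
      rw [show (p.1 - p.2) ^ 2 = (p.2 - p.1) ^ 2 by ring]
    rw [hev, smoothingKernel_eq_integral hq (p.2 - p.1), hassoc, ← integral_mul_const, ← integral_const_mul]
  simp_rw [hker]
  have hH := integrable_multiplier_mul_cexp_mul_polar hq hf hg
  rw [integral_integral_swap ((hH.const_mul (((1 / (2 * π) : ℝ) : ℂ))).congr
    (Eventually.of_forall fun r => rfl))]
  have hinner : ∀ z : ℝ, ∫ p : ℝ × ℝ, ((1 / (2 * π) : ℝ) : ℂ) *
      ((((2 / q * (1 - liaSym (z * √q))) : ℝ) : ℂ) * cexp (I * z * ((p.2 - p.1 : ℝ) : ℂ)) *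
        (f p.2 * conj (g p.1))) ∂(volume.prod volume) =
      ((1 / (2 * π) : ℝ) : ℂ) * ((((2 / q * (1 - liaSym (z * √q))) : ℝ) : ℂ) *
        ((∫ x : ℝ, f x * cexp (I * z * x)) * conj (∫ x : ℝ, g x * cexp (I * z * x)))) := by
    intro z
    have hfun : (fun p : ℝ × ℝ => ((1 / (2 * π) : ℝ) : ℂ) *
        ((((2 / q * (1 - liaSym (z * √q))) : ℝ) : ℂ) * cexp (I * z * ((p.2 - p.1 : ℝ) : ℂ)) *
          (f p.2 * conj (g p.1)))) =
        fun p : ℝ × ℝ => (((1 / (2 * π) : ℝ) : ℂ) * ((((2 / q * (1 - liaSym (z * √q))) : ℝ) : ℂ))) *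
          (cexp (I * z * ((p.2 - p.1 : ℝ) : ℂ)) * (f p.2 * conj (g p.1))) := by
      ext p
      ring
    rw [hfun, integral_const_mul, integral_prod_cexp_mul_mul_conj]
    ring
  simp_rw [hinner]
  rw [integral_const_mul]

/-! ## §3 The un-normalised transform is `C¹` when `x·f ∈ L¹`, with `F′ = i·(transform of x·f)` -/

/-- Continuity of `F(z) = ∫ f(x)e^{izx}dx` for `f ∈ L¹`. [folklore] -/
theorem continuous_unnormalisedTransform {f : ℝ → ℂ} (hf : Integrable f) :
    Continuous (fun z : ℝ => ∫ x : ℝ, f x * cexp (I * z * x)) := by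
  have hF : (fun z : ℝ => ∫ x : ℝ, f x * cexp (I * z * x)) = fun z => 𝓕 f (-z / (2 * π)) :=
    funext (unnormalisedTransform_eq_fourier f)
  rw [hF]
  have hc : Continuous (𝓕 f) :=
    VectorFourier.fourierIntegral_continuous Real.continuous_fourierChar continuous_inner hf
  exact hc.comp ((continuous_neg).div_const _)

/-- `‖F(z)‖ ≤ ‖f‖₁`. [folklore] -/
theorem norm_unnormalisedTransform_le {f : ℝ → ℂ} (z : ℝ) :
    ‖∫ x : ℝ, f x * cexp (I * z * x)‖ ≤ ∫ x : ℝ, ‖f x‖ := by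
  refine (norm_integral_le_integral_norm _).trans (le_of_eq ?_)
  congr 1 with x
  rw [norm_mul, Complex.norm_exp]
  simp only [Complex.mul_re, Complex.I_re, Complex.ofReal_re, zero_mul, Complex.I_im, Complex.ofReal_im, mul_zero,
    sub_zero, Complex.mul_im, one_mul, zero_add, Real.exp_zero, mul_one]

/-- **`F′(z) = i·∫ x f(x) e^{izx} dx`** for `f, x·f ∈ L¹`. [folklore] -/
theorem hasDerivAt_unnormalisedTransform {f : ℝ → ℂ} (hf : Integrable f)
    (hxf : Integrable (fun x : ℝ => x • f x)) (z : ℝ) :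
    HasDerivAt (fun z : ℝ => ∫ x : ℝ, f x * cexp (I * z * x))
      (I * ∫ x : ℝ, ((x : ℂ) * f x) * cexp (I * z * x)) z := by
  have hF : (fun z : ℝ => ∫ x : ℝ, f x * cexp (I * z * x)) = fun z => 𝓕 f (-z / (2 * π)) :=
    funext (unnormalisedTransform_eq_fourier f)
  rw [hF]
  have h1 : HasDerivAt (𝓕 f) (𝓕 (fun x : ℝ => (-2 * π * I * x) • f x) (-z / (2 * π))) (-z / (2 * π)) :=
    Real.hasDerivAt_fourier hf hxf _
  have h2 : HasDerivAt (fun z : ℝ => -z / (2 * π)) (-1 / (2 * π)) z := by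
    have h := (hasDerivAt_neg z).div_const (2 * π)
    simpa [neg_div] using h
  have h3 := h1.scomp z h2
  refine h3.congr_deriv ?_
  rw [← unnormalisedTransform_eq_fourier (fun x : ℝ => (-2 * π * I * x) • f x) z, Complex.real_smul,
    ← integral_const_mul, ← integral_const_mul]
  refine integral_congr_ae (Eventually.of_forall fun x => ?_)
  simp only [smul_eq_mul]
  have hπ : (π : ℂ) ≠ 0 := by exact_mod_cast Real.pi_ne_zero
  push_cast
  field_simp

end Summit.NavierStokesRegularity.NavierStokesRegularity.Theorems.MatchedKernel

end
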